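import Summits.ABC.IUTFork.Joshi.ArithHolStructure
import Summits.ABC.IUTFork.Joshi.ArithTeichmullerAction
import HarnessLib

/-!
# Joshi, *Arithmetic Teichmüller spaces I* (v4) Def. 5.1.1 — the POINTED objects of `𝔍(X,E)`: arithmetic holomorphic
# structures (with tilt datum and geometric base point, E-t10's `ATS1.ArithHolStructure`) plus the anabelomorphism

Record file of the abc-iut cell, branch E (seat abc-iut-E-t1, [J-I] carrier owner; rung LADDER-ABC:A2.E). TAKES NO SIDE
on [IUTchIII] Cor. 3.12 or on any author; typed ≠ proved ≠ endorsed. Source: K. Joshi, arXiv 2106.11452 **v4** (version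
of record; render `HOME/plan/repair/lit/renders/Joshi-ATS1-2106.11452v4-…`), **Def. 5.1.1** p.22 l.22 – p.23 l.9:
«the Arithmetic Teichmüller Space `𝔍(X,E)` of `X/E` is a category whose objects are arithmetic holomorphic structures
`(Y/E′, (E′ ↪ K, K♭ ≃ F), ∗_K : M(K) → Y^an_{E′})` where (1) `E′` is a p-adic field, (2) `F` is some algebraically closed
perfectoid field of characteristic `p > 0`, (3) `(E′ ↪ K, K♭ ≃ F)` is an `E′`-untilt of `F`, (4) `Y/E′` is a geometrically
connected, smooth, quasi-projective variety such that (5) one has `dim(Y) = dim(X)`, (6) and (a) `Y/E′` is tempered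
anabelomorphic to `X/E` i.e. one has an anabelomorphism `Π^temp_{Y/E′} ≃ Π^temp_{X/E}`, (b) and any such anabelomorphism induces an
anabelomorphism of their geometric tempered fundamental subgroups `Π^temp_{Y/K} ≃ Π^temp_{X/ℂ_p}`. Morphisms in `𝔍(X,E)` are
morphisms of the data»; Rmk. 5.1.2 p.23 l.10–13: «In the principal case of hyperbolic curves over p-adic fields … the
requirement (4)(b) [sic] is implied by (4)(a) (by [Mochizuki, 2004, Lemma 1.3.8]).» [claim: Joshi2021ATS1, status: disputed]

RELATION TO THE LANDED TYPING. `Joshi.ATSObj X` (p428170) is the BASE-POINT-FREE object of v4 Def. 5.11.1 (pairs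
`(Y/E′, (E′ ↪ K, K♭ ≃ F))` with the label `α`; tilt datum not recorded); E-t10's `ATS1.ArithHolStructure Y A F` (E-t10, landed;
`ArithHolStructure.lean`) is v4 Def. 4.1.1 ON ONE CURVE (untilt, embedding, tilt iso `ATS1.tilt U ≃+* F` on the CONCRETE
Mathlib tilt, the isometric `♯`, and the geometric base point over an abstract `BerkovichDatum`). This file assembles the
two into the POINTED object of Def. 5.1.1 and records clause (6)(b) as a named `Prop` (`GeomCompatible`; Joshi's Rmk. 5.1.2
says it is automatic for hyperbolic curves — `Rmk512`, claim-Prop). Nothing is asserted. Morphisms of pointed objects over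
DIFFERENT curves need transport of base points along isomorphisms of curves, which the `BerkovichDatum` signature (per
curve) does not provide — NOT typed (interface boundary); on the base-point-free shadows they are `ATSObj.Iso`.
-/

noncomputable section

namespace Summit.ABC.IUTFork.Joshi

open Literature.AnabelianGeometry.SemiGraphs (TemperedCurve)

variable {p : ℕ} [Fact p.Prime]

/-- **A POINTED object of `𝔍(X,E)`** ([J-I] v4 Def. 5.1.1, p.22 l.22 – p.23 l.9): a curve `Y/E′` with its tempered
fundamental group (`TemperedCurve p`), an arithmetic holomorphic structure on it in E-t10's sense (`ATS1.ArithHolStructure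
Y (𝔅 Y) F`: untilt `K`, `E′ ↪ K`, tilt iso `K♭ ≃ F`, isometric `♯`, geometric base point `∗_K : M(K) → Y^an_{E′}`) over a
family `𝔅` of Berkovich data (one per curve — the analytic-space theory, abstract) and a fixed tilt base `F`, and the
anabelomorphism `α : Π^temp(Y/E′) ≅ Π^temp(X/E)` (clause (6)(a)). [claim: Joshi2021ATS1, status: disputed] -/
structure ATSObjPointed (X : TemperedCurve p) (𝔅 : ∀ Y : TemperedCurve p, ATS1.BerkovichDatum Y) (F : Type) [NormedField F]
    [CompleteSpace F] [IsUltrametricDist F] [IsAlgClosed F] [CharP F p] : Type 1 where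
  /-- the curve `Y/E′` with `Π^temp(Y/E′)` -/
  Y : TemperedCurve p
  /-- the arithmetic holomorphic structure `(Y/E′, (E′ ↪ K, K♭ ≃ F), ∗_K)` on `Y` -/
  hol : ATS1.ArithHolStructure Y (𝔅 Y) F
  /-- clause (6)(a): the anabelomorphism `Π^temp(Y/E′) ≅ Π^temp(X/E)` -/
  α : Y.PiTemp ≃ₜ* X.PiTemp

namespace ATSObjPointed

variable {X : TemperedCurve p} {𝔅 : ∀ Y : TemperedCurve p, ATS1.BerkovichDatum Y} {F : Type} [NormedField F]
  [CompleteSpace F] [IsUltrametricDist F] [IsAlgClosed F] [CharP F p]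

/-- The base-point-free shadow (v4 Def. 5.11.1 / Thm 13.13.1 (1) «the natural functor (given by forgetting the geometric
base-point) `𝔍(X,E) → 𝔍̱(X,E)`»): forget tilt datum and base point, keep `(Y/E′, E′ ↪ K, α)` = E-t1's `ATSObj X`.
[claim: Joshi2021ATS1, status: disputed] -/
def toATSObj (A : ATSObjPointed X 𝔅 F) : ATSObj X :=
  ⟨A.Y, A.hol.U, A.hol.emb, A.hol.continuous_emb, A.α⟩

/-- The shadow has the same perfectoid field. [folklore] -/
theorem toATSObj_U (A : ATSObjPointed X 𝔅 F) : A.toATSObj.U = A.hol.U := rfl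

/-- The shadow has the same curve. [folklore] -/
theorem toATSObj_Y (A : ATSObjPointed X 𝔅 F) : A.toATSObj.Y = A.Y := rfl

/-- Forgetting only the label: the underlying arithmetic holomorphic structure's own object `(Y/E′, E′ ↪ K, id)` of `𝔍(Y,E′)`
(E-t10's `ArithHolStructure.toATSObj`) is the shadow relabelled by `α⁻¹` … recorded as the equality of perfectoid fields
and embeddings. [folklore] -/
theorem hol_toATSObj_U (A : ATSObjPointed X 𝔅 F) : A.hol.toATSObj.U = A.toATSObj.U := rfl

/-- **Clause (6)(b) of Def. 5.1.1** («any such anabelomorphism induces an anabelomorphism of their geometric tempered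
fundamental subgroups `Π^temp_{Y/K} ≃ Π^temp_{X/ℂ_p}`»), typed on the carriers: `α` carries the geometric subgroup
`Δ^temp_Y = ker(aug_Y)` ONTO `Δ^temp_X` (equivalently `A.toATSObj.geomSubgroup = X.DeltaTemp`). Named `Prop`; by Rmk. 5.1.2
automatic for hyperbolic curves (`Rmk512`). [claim: Joshi2021ATS1, status: disputed] -/
@[claim "Joshi2021ATS1" "disputed"]
def GeomCompatible (A : ATSObjPointed X 𝔅 F) : Prop := A.Y.DeltaTemp.map A.α.toMonoidHom = X.DeltaTemp

/-- `GeomCompatible` is the statement that the shadow's `geomSubgroup` (p428170) is `Δ^temp_X`. [folklore] -/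
theorem geomCompatible_iff (A : ATSObjPointed X 𝔅 F) : A.GeomCompatible ↔ A.toATSObj.geomSubgroup = X.DeltaTemp :=
  Iff.rfl

/-- **Rmk. 5.1.2** (p.23 l.10–13): «In the principal case of hyperbolic curves over p-adic fields … the requirement (b) is
implied by (a) (by [Mochizuki, 2004, Lemma 1.3.8])» — every pointed object is geometrically compatible. Named claim-Prop
(the cited lemma — the geometric subgroup is group-theoretically characteristic — is not in the tree). [claim: Joshi2021ATS1, status: disputed] -/
@[claim "Joshi2021ATS1" "disputed"]
def Rmk512 (X : TemperedCurve p) (𝔅 : ∀ Y : TemperedCurve p, ATS1.BerkovichDatum Y) (F : Type) [NormedField F]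
    [CompleteSpace F] [IsUltrametricDist F] [IsAlgClosed F] [CharP F p] : Prop :=
  ∀ A : ATSObjPointed X 𝔅 F, A.GeomCompatible

/-- The pointed SELF object: an arithmetic holomorphic structure on `X` itself gives the object `(X/E, (E ↪ K, K♭ ≃ F), ∗_K; id)`
(Def. 5.1.1 allows `Y = X`; E-t10's Prop. 4.1.10 / `toATSObj`). [claim: Joshi2021ATS1, status: disputed] -/
def self (S : ATS1.ArithHolStructure X (𝔅 X) F) : ATSObjPointed X 𝔅 F := ⟨X, S, ContinuousMulEquiv.refl _⟩

/-- The self object is geometrically compatible (identity label). [folklore] -/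
theorem self_geomCompatible (S : ATS1.ArithHolStructure X (𝔅 X) F) : (self S).GeomCompatible := by
  show X.DeltaTemp.map (ContinuousMulEquiv.refl X.PiTemp).toMonoidHom = X.DeltaTemp
  ext g
  simp only [Subgroup.mem_map]
  constructor
  · rintro ⟨x, hx, rfl⟩; exact hx
  · intro hg; exact ⟨g, hg, rfl⟩

/-- The shadow of the self object is E-t10's `ArithHolStructure.toATSObj` (= E-t1's `ATSObj.self`). [folklore] -/
theorem self_toATSObj (S : ATS1.ArithHolStructure X (𝔅 X) F) : (self S).toATSObj = S.toATSObj := rfl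

/-- `𝔍(X,E)` (pointed) is non-empty as soon as `X` carries one arithmetic holomorphic structure over `F` (for `F = ℂ_p♭` and
`K = ℂ_p` this is the standard structure of [J-I] Thm 8.4.1's statement; constructing it needs a base point `∗_{ℂ_p}`, i.e. a
value of the abstract `BerkovichDatum`, hence it is a hypothesis here). [folklore] -/
theorem nonempty_of (S : ATS1.ArithHolStructure X (𝔅 X) F) : Nonempty (ATSObjPointed X 𝔅 F) := ⟨self S⟩

/-- Relabelling by `Aut(Π)` (v4 Prop. 5.9.1 (2) / `ATSObj.relabel`) lifts to pointed objects (the holomorphic structure is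
untouched). [claim: Joshi2021ATS1, status: disputed] -/
def relabel (σ : X.PiTemp ≃ₜ* X.PiTemp) (A : ATSObjPointed X 𝔅 F) : ATSObjPointed X 𝔅 F := ⟨A.Y, A.hol, A.α.trans σ⟩

/-- Relabelling commutes with the shadow. [folklore] -/
theorem toATSObj_relabel (σ : X.PiTemp ≃ₜ* X.PiTemp) (A : ATSObjPointed X 𝔅 F) :
    (A.relabel σ).toATSObj = A.toATSObj.relabel σ := rfl

end ATSObjPointed

end Summit.ABC.IUTFork.Joshi

end
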